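import Mathlib
import Summits.Ventures.HodgeRepro.Tier4.Target
import Summits.Ventures.HodgeRepro.Tier4.Line3.Defs
import Summits.Ventures.HodgeRepro.Tier4.Line3.GoodSplitBracket

/-!
# Tier4/Line3/BadPlaceBracket — the four-slot bracket of the wall `pos_localiser` at a BAD place (kernel rung)

Blind re-derivation cell `pub-hodge-repro`, Tier 4 «PROVE THE STEP» (README §9–§10), LINE L3, seat t4-L3-p1 (g2),
wall-breaker support for the declared wall `pos_localiser` (Skeleton v0.29 L490; paper proof CENSUS-v0.29.md §1 (iii)).
SUPPORT, like `GoodSplitBracket`: consumed by no filed statement, touches no statement, proves nothing about `coefQ`.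

## Part A — the bracket over an abstract local torus (the algebra of §1 (iii))

A local torus `T` (commutative), a type `V` of local vectors with a map `act : T → V → V` (the torus action; no axiom
of it is used), four slot supports `B j ⊆ V` (the balls `xm_j + ϖ^n L_v`; `B 2 = B 0`, `B 3 = B 1` for the symmetric
tuple) and four characters `μ j : T →* ℂ`.  The slot average at `x` is `μ_j(t_x)^{−1} · vol` for an ADMISSIBLE `t_x`
(`act t_x x ∈ B j`, chosen) and `0` if there is none — `slotAvg`.  It is well defined under the COSET property
`hcoset`: two admissible elements differ by an element on which `μ_j` is trivial (§1 (iii): the admissible set is a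
coset of `U(1) ∩ (1 + ϖ^{n−m} 𝒪)`, `n ≥ cond(μ_j) + m`).  `bracket_eq`: at admissible `t_a` (slots 0, 2 at `x = g a`)
and `t_b` (slots 1, 3 at `y = g b`) the bracket is `vol⁴ · ε(t_a)^{−1} · [μ₁ μ̄₃](t_b / t_a)^{−1}` with
`ε = μ₀ μ₁ μ̄₂ μ̄₃`.  `bracket_nonneg`: under the DISPLAYED face identity `hε : ε ≡ 1` on `T` and the DISPLAYED pairing
congruence `hpair` (on the pairs `R x y` of interest, `t_b / t_a` lies where `μ₁ μ̄₃` is trivial) the bracket is a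
non-negative real: `vol⁴` or `0`.

## Part B — the two congruences from the valuation (the arithmetic of §1 (iii))

Over a field `K` with a valuation `v` (the line's `v_𝔭` on `E′`, or a completion) and a ring automorphism `c` (the
conjugation), the local vectors are the SPLIT-MODEL pairs `z = (z₁, z₂) ∈ K³ × K³` with the torus `Kˣ` acting by
`t ⋅ (z₁, z₂) = (t z₁, t⁻¹ z₂)` (`splitAct`), a rational `x ∈ K³` sits at `ι x = (x, c x)`, the `𝔭`-component of the
hermitian form is `pairSplit H z z' = Σ z₂ᵢ H_ij z′₁ⱼ` (`pairSplit H (ι x) (ι y) = ⟨x, y⟩_H`), and the depth-`n` ball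
around `a` is `{z | z₁ ≡ a, z₂ ≡ c a mod 𝔭^n}` (`Ball`) — at a NON-split place (`v ∘ c = v`, torus `c(t) = t⁻¹`) this is
the usual ball `x ≡ a mod 𝔭^n` for both halves, at a split place the two-component ball of `LocS.supp`.
* `pair_congruence`: if `t_a ⋅ z ∈ Ball n a`, `t_b ⋅ z′ ∈ Ball n b`, `H` integral, `a, b` integral, `pairSplit H z z′ =
  ⟨a, b⟩_H` (a class representative) and `v(⟨a, b⟩_H) = ofAdd(−e)`, then `v(t_b / t_a − 1) ≤ ofAdd(e − n)`:
  `(t_b/t_a) ⟨a, b⟩ − ⟨a, b⟩ = ⟨t_a z − ι a, t_b z′⟩ + ⟨ι a, t_b z′ − ι b⟩`, both of valuation `≤ ofAdd(−n)`.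
* `coset_congruence`: if `t ⋅ z` and `t' ⋅ z` both lie in `Ball n a` and `a` has a coordinate of valuation
  `ofAdd(−m)`, `m < n`, then `v(t' / t − 1) ≤ ofAdd(m − n)` (the ball's stabiliser).
* `bracket_nonneg_of_valuation`: Part A on the split model with the two congruences discharged — the displayed
  hypotheses are the CONDUCTOR conditions (`μ_j` trivial on `v(t − 1) ≤ ofAdd(m − n)`, `μ₁ μ̄₃` trivial on
  `v(t − 1) ≤ ofAdd(e − n)`: the depth `n ≥ cond + e + m` of crit-2's condition (E)) and the face identity `hε`.

## What is NOT here (the wall's residual at a bad place)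

The identification of the genuine local torus average `∫_{U(1)_v} μ_{j,v}(t)^{−1} φ_{j,v}(t x) dt` with `slotAvg`
(the Haar integral over the coset `t_x · U_{n−m}`, `vol = vol(U_{n−m})`), the factorisation of the adelic average, the
choice of the depth `n` after `a, b, L₀, μ` (a witness-side choice), and the face identity `hε` itself (O-L3-7: not
carried by the typed data).  Nothing here asserts anything about the truth of (P); HC_CM is NOT proved by anyone in
this repository.
-/

set_option autoImplicit false

noncomputable section

namespace Summit.Ventures.HodgeRepro.Tier4.Line3

open Summit.Ventures.HodgeRepro.Tier4
open Matrix
open scoped ComplexConjugate WithZero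

open scoped Classical

namespace BadPlace

section Abstract

variable {T : Type*} [CommGroup T] {V : Type*}

/-- THE SLOT AVERAGE at `x` for the character `μ`, the support `B` and the torus action `act`: `μ(t_x)⁻¹ · vol` at an
admissible `t_x` (chosen), `0` if none. -/
def slotAvg (act : T → V → V) (μ : T →* ℂ) (B : Set V) (vol : ℝ) (x : V) : ℂ :=
  if h : ∃ t : T, act t x ∈ B then (μ (Classical.choose h))⁻¹ * vol else 0

/-- No admissible torus element: the slot average is `0`. -/
theorem slotAvg_eq_zero (act : T → V → V) (μ : T →* ℂ) (B : Set V) (vol : ℝ) {x : V}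
    (h : ¬ ∃ t : T, act t x ∈ B) : slotAvg act μ B vol x = 0 := by
  unfold slotAvg
  rw [dif_neg h]

/-- WELL-DEFINEDNESS: under the coset property at `x` (two admissible elements differ by an element on which `μ` is
trivial), the slot average at `x` is `μ(t)⁻¹ · vol` for ANY admissible `t`. -/
theorem slotAvg_eq (act : T → V → V) (μ : T →* ℂ) (B : Set V) (vol : ℝ) {x : V}
    (hcoset : ∀ t t' : T, act t x ∈ B → act t' x ∈ B → μ (t' / t) = 1)
    {t : T} (ht : act t x ∈ B) : slotAvg act μ B vol x = (μ t)⁻¹ * vol := by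
  unfold slotAvg
  have h : ∃ t : T, act t x ∈ B := ⟨t, ht⟩
  rw [dif_pos h]
  have h1 : μ (t / Classical.choose h) = 1 := hcoset _ t (Classical.choose_spec h) ht
  have h2 : μ t = μ (Classical.choose h) := by
    have : t = Classical.choose h * (t / Classical.choose h) := (mul_div_cancel _ _).symm
    rw [this, map_mul, h1, mul_one]
  rw [h2]

/-- THE FOUR-SLOT BRACKET at `(x, y)`: `c₀(x) c₁(y) · conj(c₂(x) c₃(y))`. -/
def bracket (act : T → V → V) (μ : Fin 4 → T →* ℂ) (B : Fin 4 → Set V) (vol : ℝ) (x y : V) : ℂ :=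
  slotAvg act (μ 0) (B 0) vol x * slotAvg act (μ 1) (B 1) vol y *
    conj (slotAvg act (μ 2) (B 2) vol x * slotAvg act (μ 3) (B 3) vol y)

/-- THE VALUE OF THE BRACKET at admissible `t_a` (slots `0, 2`, at `x`) and `t_b` (slots `1, 3`, at `y`):
`vol⁴ · ε(t_a)⁻¹ · [μ₁ μ̄₃](t_b / t_a)⁻¹`, `ε = μ₀ μ₁ μ̄₂ μ̄₃`. -/
theorem bracket_eq (act : T → V → V) (μ : Fin 4 → T →* ℂ) (B : Fin 4 → Set V) (vol : ℝ)
    (hB02 : B 2 = B 0) (hB13 : B 3 = B 1) {x y : V}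
    (hcx : ∀ (j : Fin 4) (t t' : T), act t x ∈ B j → act t' x ∈ B j → μ j (t' / t) = 1)
    (hcy : ∀ (j : Fin 4) (t t' : T), act t y ∈ B j → act t' y ∈ B j → μ j (t' / t) = 1)
    {ta tb : T} (hta : act ta x ∈ B 0) (htb : act tb y ∈ B 1) :
    bracket act μ B vol x y =
      ((vol : ℂ) ^ 4) * (μ 0 ta * μ 1 ta * conj (μ 2 ta) * conj (μ 3 ta))⁻¹ *
        (μ 1 (tb / ta) * conj (μ 3 (tb / ta)))⁻¹ := by
  have hta2 : act ta x ∈ B 2 := by rw [hB02]; exact hta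
  have htb3 : act tb y ∈ B 3 := by rw [hB13]; exact htb
  unfold bracket
  rw [slotAvg_eq act (μ 0) (B 0) vol (hcx 0) hta, slotAvg_eq act (μ 1) (B 1) vol (hcy 1) htb,
    slotAvg_eq act (μ 2) (B 2) vol (hcx 2) hta2, slotAvg_eq act (μ 3) (B 3) vol (hcy 3) htb3]
  have e1 : μ 1 tb = μ 1 ta * μ 1 (tb / ta) := by rw [← map_mul, mul_div_cancel]
  have e3 : μ 3 tb = μ 3 ta * μ 3 (tb / ta) := by rw [← map_mul, mul_div_cancel]
  rw [e1, e3]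
  simp only [map_mul, Complex.conj_ofReal, map_inv₀, mul_inv]
  ring

/-- TERMWISE POSITIVITY AT A BAD PLACE under the DISPLAYED face identity `hε` (`ε ≡ 1` on the local torus), the coset
property and the DISPLAYED pairing congruence `hpair` on the pairs `R x y` of interest (`μ₁ μ̄₃` trivial at
`t_b / t_a` for admissible `t_a`, `t_b`): the bracket is a non-negative real (`vol⁴` or `0`). -/
theorem bracket_nonneg (act : T → V → V) (μ : Fin 4 → T →* ℂ) (B : Fin 4 → Set V) (vol : ℝ)
    (hB02 : B 2 = B 0) (hB13 : B 3 = B 1)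
    (hcoset : ∀ (j : Fin 4) (x : V) (t t' : T), act t x ∈ B j → act t' x ∈ B j → μ j (t' / t) = 1)
    (hε : ∀ t : T, μ 0 t * μ 1 t * conj (μ 2 t) * conj (μ 3 t) = 1)
    (R : V → V → Prop)
    (hpair : ∀ (x y : V), R x y → ∀ (ta tb : T), act ta x ∈ B 0 → act tb y ∈ B 1 →
      μ 1 (tb / ta) * conj (μ 3 (tb / ta)) = 1)
    {x y : V} (hR : R x y) : (bracket act μ B vol x y).im = 0 ∧ 0 ≤ (bracket act μ B vol x y).re := by
  by_cases hx : ∃ t : T, act t x ∈ B 0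
  · by_cases hy : ∃ t : T, act t y ∈ B 1
    · obtain ⟨ta, hta⟩ := hx
      obtain ⟨tb, htb⟩ := hy
      rw [bracket_eq act μ B vol hB02 hB13 (fun j => hcoset j x) (fun j => hcoset j y) hta htb, hε ta,
        hpair x y hR ta tb hta htb, inv_one, mul_one, mul_one]
      have h4 : ((vol : ℂ) ^ 4) = ((vol ^ 4 : ℝ) : ℂ) := by push_cast; ring
      rw [h4, Complex.ofReal_im, Complex.ofReal_re]
      exact ⟨rfl, by positivity⟩
    · unfold bracket
      have hy3 : ¬ ∃ t : T, act t y ∈ B 3 := by rw [hB13]; exact hy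
      rw [slotAvg_eq_zero act (μ 1) (B 1) vol hy, slotAvg_eq_zero act (μ 3) (B 3) vol hy3]
      simp
  · unfold bracket
    have hx2 : ¬ ∃ t : T, act t x ∈ B 2 := by rw [hB02]; exact hx
    rw [slotAvg_eq_zero act (μ 0) (B 0) vol hx, slotAvg_eq_zero act (μ 2) (B 2) vol hx2]
    simp

end Abstract

section Valuation

variable {K : Type*} [Field K]

/-- The split-model torus action of `Kˣ` on pairs: `t ⋅ (z₁, z₂) = (t z₁, t⁻¹ z₂)`. -/
def splitAct (t : Kˣ) (z : (Fin 3 → K) × (Fin 3 → K)) : (Fin 3 → K) × (Fin 3 → K) :=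
  ((t : K) • z.1, ((t : K)⁻¹) • z.2)

/-- A rational vector in the split model: `ι x = (x, c x)`. -/
def ι (c : K ≃+* K) (x : Fin 3 → K) : (Fin 3 → K) × (Fin 3 → K) := (x, fun i => c (x i))

/-- The `𝔭`-component of the hermitian form on the split model: `Σ_{i j} z₂ᵢ H_ij z′₁ⱼ` (the conjugate side of the
first argument against the direct side of the second). -/
def pairSplit (H : Matrix (Fin 3) (Fin 3) K) (z z' : (Fin 3 → K) × (Fin 3 → K)) : K :=
  ∑ i, z.2 i * ∑ j, H i j * z'.1 j

/-- On rational points the split pairing is the hermitian form. -/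
theorem pairSplit_ι (c : K ≃+* K) (H : Matrix (Fin 3) (Fin 3) K) (x y : Fin 3 → K) :
    pairSplit H (ι c x) (ι c y) = hform c H x y := by
  unfold pairSplit ι hform
  simp only [Matrix.mulVec, dotProduct]

/-- The depth-`n` ball around `a` in the split model: `z₁ ≡ a` and `z₂ ≡ c a` modulo `𝔭^n`. -/
def Ball (v : Valuation K ℤᵐ⁰) (c : K ≃+* K) (n : ℕ) (a : Fin 3 → K) : Set ((Fin 3 → K) × (Fin 3 → K)) :=
  {z | (∀ i, v (z.1 i - a i) ≤ ↑(Multiplicative.ofAdd (-(n : ℤ)))) ∧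
    ∀ i, v (z.2 i - c (a i)) ≤ ↑(Multiplicative.ofAdd (-(n : ℤ)))}

/-- The ultrametric bound for the split pairing. -/
theorem pairSplit_le (v : Valuation K ℤᵐ⁰) (H : Matrix (Fin 3) (Fin 3) K)
    (hH : ∀ i j, v (H i j) ≤ 1) {z z' : (Fin 3 → K) × (Fin 3 → K)} {A B : ℤᵐ⁰}
    (hz : ∀ i, v (z.2 i) ≤ A) (hz' : ∀ j, v (z'.1 j) ≤ B) : v (pairSplit H z z') ≤ A * B := by
  unfold pairSplit
  apply Valuation.map_sum_le
  intro i _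
  rw [Valuation.map_mul]
  refine mul_le_mul' (hz i) ?_
  apply Valuation.map_sum_le
  intro j _
  rw [Valuation.map_mul]
  calc v (H i j) * v (z'.1 j) ≤ 1 * B := mul_le_mul' (hH i j) (hz' j)
    _ = B := one_mul B

/-- The split pairing is additive in each argument (the difference identity used by the pairing congruence). -/
theorem pairSplit_sub_sub (H : Matrix (Fin 3) (Fin 3) K) (z w z' w' : (Fin 3 → K) × (Fin 3 → K)) :
    pairSplit H z z' - pairSplit H w w' = pairSplit H (z - w) z' + pairSplit H w (z' - w') := by
  unfold pairSplit
  simp only [Prod.fst_sub, Prod.snd_sub, Pi.sub_apply, sub_mul, mul_sub, Finset.sum_sub_distrib]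
  ring

/-- The split pairing is `(t'/t)`-homogeneous under the torus: `pairSplit (t ⋅ z) (t' ⋅ z') = (t'/t) pairSplit z z'`. -/
theorem pairSplit_splitAct (H : Matrix (Fin 3) (Fin 3) K) (t t' : Kˣ) (z z' : (Fin 3 → K) × (Fin 3 → K)) :
    pairSplit H (splitAct t z) (splitAct t' z') = ((t' : K) / (t : K)) * pairSplit H z z' := by
  unfold pairSplit splitAct
  simp only [Pi.smul_apply, smul_eq_mul, Finset.mul_sum]
  refine Finset.sum_congr rfl (fun i _ => Finset.sum_congr rfl (fun j _ => ?_))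
  ring

/-- `ofAdd m ≤ ofAdd m'` in `ℤᵐ⁰` for `m ≤ m'`. -/
theorem coe_ofAdd_le_coe_ofAdd {m m' : ℤ} (h : m ≤ m') :
    (↑(Multiplicative.ofAdd m) : ℤᵐ⁰) ≤ ↑(Multiplicative.ofAdd m') := by
  rw [WithZero.coe_le_coe, Multiplicative.ofAdd_le]
  exact h

/-- Integrality of a ball coordinate: `w` is integral when the centre is (`n ≥ 0`). -/
theorem integral_of_near (v : Valuation K ℤᵐ⁰) {n : ℕ} {w a : Fin 3 → K}
    (ha : ∀ i, v (a i) ≤ 1) (hw : ∀ i, v (w i - a i) ≤ ↑(Multiplicative.ofAdd (-(n : ℤ)))) :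
    ∀ i, v (w i) ≤ 1 := by
  intro i
  have h1 : w i = (w i - a i) + a i := by ring
  rw [h1]
  refine (Valuation.map_add_le_max' v _ _).trans (max_le ?_ (ha i))
  refine (hw i).trans ?_
  rw [← WithZero.coe_one, ← ofAdd_zero]
  exact coe_ofAdd_le_coe_ofAdd (by omega)

/-- THE PAIRING CONGRUENCE (§1 (iii)): `t_a ⋅ z ∈ Ball n a`, `t_b ⋅ z′ ∈ Ball n b`, `H` and `a, b` integral,
`pairSplit H z z′ = ⟨a, b⟩_H` and `v ⟨a, b⟩_H = ofAdd(−e)` give `v (t_b / t_a − 1) ≤ ofAdd (e − n)`. -/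
theorem pair_congruence (v : Valuation K ℤᵐ⁰) (c : K ≃+* K) (H : Matrix (Fin 3) (Fin 3) K)
    (hH : ∀ i j, v (H i j) ≤ 1) {n : ℕ} {e : ℤ} {a b : Fin 3 → K} {z z' : (Fin 3 → K) × (Fin 3 → K)}
    {ta tb : Kˣ} (ha : ∀ i, v (c (a i)) ≤ 1) (hb : ∀ j, v (b j) ≤ 1)
    (hz : splitAct ta z ∈ Ball v c n a) (hz' : splitAct tb z' ∈ Ball v c n b)
    (hzz : pairSplit H z z' = hform c H a b) (hab : v (hform c H a b) = ↑(Multiplicative.ofAdd (-e))) :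
    v (((tb : K) / (ta : K)) - 1) ≤ ↑(Multiplicative.ofAdd (e - n)) := by
  set P : K := hform c H a b with hP
  -- `(t_b / t_a) P − P = pairSplit (t_a z) (t_b z′) − pairSplit (ι a) (ι b)`
  have hι : pairSplit H (ι c a) (ι c b) = P := pairSplit_ι c H a b
  have hval : pairSplit H (splitAct ta z) (splitAct tb z') = ((tb : K) / (ta : K)) * P := by
    rw [pairSplit_splitAct, hzz]
  have hdiff := pairSplit_sub_sub H (splitAct ta z) (ι c a) (splitAct tb z') (ι c b)
  rw [hval, hι] at hdiff
  -- both terms have valuation `≤ ofAdd (−n)`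
  have hz'int : ∀ j, v ((splitAct tb z').1 j) ≤ 1 := integral_of_near v hb hz'.1
  have t1 : v (pairSplit H (splitAct ta z - ι c a) (splitAct tb z')) ≤
      ↑(Multiplicative.ofAdd (-(n : ℤ))) := by
    have := pairSplit_le v H hH (z := splitAct ta z - ι c a) (z' := splitAct tb z')
      (A := ↑(Multiplicative.ofAdd (-(n : ℤ)))) (B := 1)
      (fun i => by
        rw [Prod.snd_sub, Pi.sub_apply]
        exact hz.2 i) hz'int
    simpa using this
  have t2 : v (pairSplit H (ι c a) (splitAct tb z' - ι c b)) ≤ ↑(Multiplicative.ofAdd (-(n : ℤ))) := by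
    have := pairSplit_le v H hH (z := ι c a) (z' := splitAct tb z' - ι c b)
      (A := 1) (B := ↑(Multiplicative.ofAdd (-(n : ℤ)))) ha
      (fun j => by
        rw [Prod.fst_sub, Pi.sub_apply]
        exact hz'.1 j)
    simpa using this
  have hsum : v (((tb : K) / (ta : K)) * P - P) ≤ ↑(Multiplicative.ofAdd (-(n : ℤ))) := by
    rw [hdiff]
    exact (Valuation.map_add_le_max' v _ _).trans (max_le t1 t2)
  have hfac : ((tb : K) / (ta : K)) * P - P = (((tb : K) / (ta : K)) - 1) * P := by ring
  rw [hfac, Valuation.map_mul, hab] at hsum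
  have hpos : (0 : ℤᵐ⁰) < ↑(Multiplicative.ofAdd (-e)) := WithZero.zero_lt_coe _
  have h2 : v (((tb : K) / (ta : K)) - 1) ≤
      (↑(Multiplicative.ofAdd (-(n : ℤ))) : ℤᵐ⁰) / ↑(Multiplicative.ofAdd (-e)) :=
    (le_div_iff₀ hpos).mpr hsum
  refine h2.trans (le_of_eq ?_)
  rw [← WithZero.coe_div, ← ofAdd_sub]
  congr 2
  ring

/-- THE COSET CONGRUENCE (§1 (iii), the ball's stabiliser): if `t ⋅ z` and `t' ⋅ z` both lie in `Ball n a` and some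
coordinate of `a` has valuation `ofAdd(−m)` with `m < n`, then `v (t' / t − 1) ≤ ofAdd (m − n)`. -/
theorem coset_congruence (v : Valuation K ℤᵐ⁰) (c : K ≃+* K) {n : ℕ} {m : ℤ} (hmn : m < n)
    {a : Fin 3 → K} {z : (Fin 3 → K) × (Fin 3 → K)} {t t' : Kˣ} {i₀ : Fin 3}
    (hi₀ : v (a i₀) = ↑(Multiplicative.ofAdd (-m)))
    (ht : splitAct t z ∈ Ball v c n a) (ht' : splitAct t' z ∈ Ball v c n a) :
    v (((t' : K) / (t : K)) - 1) ≤ ↑(Multiplicative.ofAdd (m - n)) := by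
  have h1 : v ((t : K) * z.1 i₀ - a i₀) ≤ ↑(Multiplicative.ofAdd (-(n : ℤ))) := by
    simpa [splitAct] using ht.1 i₀
  have h1' : v ((t' : K) * z.1 i₀ - a i₀) ≤ ↑(Multiplicative.ofAdd (-(n : ℤ))) := by
    simpa [splitAct] using ht'.1 i₀
  -- `v (t z₁_{i₀}) = v (a_{i₀})`: the deviation is strictly smaller
  have hlt : v ((t : K) * z.1 i₀ - a i₀) < v (a i₀) := by
    rw [hi₀]
    refine lt_of_le_of_lt h1 ?_
    rw [WithZero.coe_lt_coe, Multiplicative.ofAdd_lt]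
    omega
  have hval : v ((t : K) * z.1 i₀) = v (a i₀) := by
    have h := Valuation.map_add_eq_of_lt_left v (x := a i₀) (y := (t : K) * z.1 i₀ - a i₀) hlt
    rw [add_sub_cancel] at h
    exact h
  -- `(t' − t) z₁_{i₀} = (t' z₁ − a) − (t z₁ − a)`
  have hd : v (((t' : K) - (t : K)) * z.1 i₀) ≤ ↑(Multiplicative.ofAdd (-(n : ℤ))) := by
    have e : ((t' : K) - (t : K)) * z.1 i₀ = ((t' : K) * z.1 i₀ - a i₀) - ((t : K) * z.1 i₀ - a i₀) := by ring
    rw [e]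
    exact Valuation.map_sub_le v h1' h1
  -- `t'/t − 1 = ((t' − t) z₁_{i₀}) / (t z₁_{i₀})`
  have hne : v ((t : K) * z.1 i₀) ≠ 0 := by
    rw [hval, hi₀]
    exact WithZero.coe_ne_zero
  have hz0 : z.1 i₀ ≠ 0 := by
    intro h0
    apply hne
    rw [h0, mul_zero, Valuation.map_zero]
  have hq : ((t' : K) / (t : K)) - 1 = (((t' : K) - (t : K)) * z.1 i₀) / ((t : K) * z.1 i₀) := by
    have ht0 : (t : K) ≠ 0 := Units.ne_zero t
    field_simp
  rw [hq, Valuation.map_div, hval, hi₀]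
  have hpos : (0 : ℤᵐ⁰) < ↑(Multiplicative.ofAdd (-m)) := WithZero.zero_lt_coe _
  refine (div_le_iff₀ hpos).mpr (hd.trans (le_of_eq ?_))
  rw [← WithZero.coe_mul, ← ofAdd_add]
  congr 2
  ring

/-- TERMWISE POSITIVITY AT A BAD PLACE, the congruences DISCHARGED FROM THE VALUATION: on the split model around the
symmetric centre `(a, b)` with contents `m_a`, `m_b` (`v (a i₀) = ofAdd (−m_a)`, `v (b j₀) = ofAdd (−m_b)`), at depth
`n > max(m_a, m_b)` with `v ⟨a, b⟩_H = ofAdd (−e)`, for characters with the CONDUCTOR conditions (`μ_j` trivial on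
`v (t − 1) ≤ ofAdd (m_a − n)` resp. `ofAdd (m_b − n)`, `μ₁ μ̄₃` trivial on `v (t − 1) ≤ ofAdd (e − n)`) and the face
identity `hε`, the bracket at every pair `(z, z′)` with `pairSplit H z z′ = ⟨a, b⟩_H` (e.g. `(ι x, ι y)` with
`⟨x, y⟩_H = ⟨a, b⟩_H`, a class representative) is a non-negative real. -/
theorem bracket_nonneg_of_valuation (v : Valuation K ℤᵐ⁰) (c : K ≃+* K) (H : Matrix (Fin 3) (Fin 3) K)
    (hH : ∀ i j, v (H i j) ≤ 1) (μ : Fin 4 → Kˣ →* ℂ) (vol : ℝ) {n : ℕ} {e ma mb : ℤ} {a b : Fin 3 → K}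
    (ha : ∀ i, v (c (a i)) ≤ 1) (hb : ∀ j, v (b j) ≤ 1) {i₀ j₀ : Fin 3}
    (hia : v (a i₀) = ↑(Multiplicative.ofAdd (-ma))) (hjb : v (b j₀) = ↑(Multiplicative.ofAdd (-mb)))
    (hman : ma < n) (hmbn : mb < n) (hab : v (hform c H a b) = ↑(Multiplicative.ofAdd (-e)))
    (hcond_a : ∀ j : Fin 4, ∀ t : Kˣ, v ((t : K) - 1) ≤ ↑(Multiplicative.ofAdd (ma - n)) → μ j t = 1)
    (hcond_b : ∀ j : Fin 4, ∀ t : Kˣ, v ((t : K) - 1) ≤ ↑(Multiplicative.ofAdd (mb - n)) → μ j t = 1)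
    (hcond_13 : ∀ t : Kˣ, v ((t : K) - 1) ≤ ↑(Multiplicative.ofAdd (e - n)) → μ 1 t * conj (μ 3 t) = 1)
    (hε : ∀ t : Kˣ, μ 0 t * μ 1 t * conj (μ 2 t) * conj (μ 3 t) = 1)
    {z z' : (Fin 3 → K) × (Fin 3 → K)} (hzz : pairSplit H z z' = hform c H a b) :
    (bracket splitAct μ ![Ball v c n a, Ball v c n b, Ball v c n a, Ball v c n b] vol z z').im = 0 ∧
      0 ≤ (bracket splitAct μ ![Ball v c n a, Ball v c n b, Ball v c n a, Ball v c n b] vol z z').re := by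
  refine bracket_nonneg splitAct μ ![Ball v c n a, Ball v c n b, Ball v c n a, Ball v c n b] vol rfl rfl
    ?_ hε (fun w w' => pairSplit H w w' = hform c H a b) ?_ hzz
  · -- the coset property, slot by slot
    intro j w t t' ht ht'
    fin_cases j
    · exact hcond_a 0 _ (by simpa using coset_congruence v c hman hia ht ht')
    · exact hcond_b 1 _ (by simpa using coset_congruence v c hmbn hjb ht ht')
    · exact hcond_a 2 _ (by simpa using coset_congruence v c hman hia ht ht')
    · exact hcond_b 3 _ (by simpa using coset_congruence v c hmbn hjb ht ht')
  · -- the pairing congruence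
    intro w w' hw ta tb hta htb
    exact hcond_13 _ (by simpa using pair_congruence v c H hH ha hb hta htb hw hab)

end Valuation

end BadPlace

end Summit.Ventures.HodgeRepro.Tier4.Line3

end
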